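import Summits.BirchSwinnertonDyer.BirchSwinnertonDyer.Theorems.ManinLocalTwoThreeStevensCurvePresentation
import Summits.BirchSwinnertonDyer.BirchSwinnertonDyer.Theorems.ManinLocalTwoThreeStevensCurveCuspSeries
import Summits.BirchSwinnertonDyer.BirchSwinnertonDyer.Theorems.ManinLocalTwoThreeQExpansionExtension
import Summits.BirchSwinnertonDyer.BirchSwinnertonDyer.Theorems.EisensteinDepletionAtTwoStarOptBNSFX1RatPres
import Literature.NumberTheory.EllipticCurves.HeckeOperatorsGamma1QExpansionProofs
import Literature.NumberTheory.EllipticCurves.ModularCurveSturmProofs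
import HarnessLib

/-!
# A RATIONAL `Γ₁(N)`-presentation of `℘_{Λ_W}(ℰ_f)` under Stevens' inclusion `Λ₁(f) ⊆ Λ_W`
(route `ManinLocalTwoThree`, crux C2 stmt-BirchSwinnertonDyer-22967; cell bsd-f2-manin, prover p3 gen 21; step (0) of the T-es-75 discharge road — the
LEAD's step (1) «Galois action on translates» and p2's step (2) «cusp values as leading coefficients» both start from forms with RATIONAL
`q`-expansions presenting `x∘φ₁`; this file supplies them, fact-free, for every `X₀(N)`-datum whose Néron lattice contains `Λ₁(f)` — in particular
for the optimal `X₁(N)`-datum of Manin constant `1` on the Stevens curve `ℂ/Λ₁(f)` (`…StevensCurveDatum`), for which `x∘φ₁ = ℘_{Λ₁}(ℰ_f) − b₂/12`)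

For an elliptic `W/ℚ` with an `X₀(N)`-datum `D` (any Manin constant; `W` need not be minimal) such that `Λ₁(f) ⊆ Λ_W` (Stevens' inclusion; for a
globally minimal `W` it is the CDT-consequence `CDivisionInt.periodLatticeGamma1_le_neron_of_CDTInt`, for the Stevens curve it holds by construction):

* `hasSum_qExpansion_coeff_gamma0` — `Σ aₘ(G) 𝕢ᵐ = G(τ)` on `ℍ` for `G ∈ S_k(Γ₀(N))`;
* `cuspCoeff_rat_of_hasSum` — a cusp form on `Γ₁(N)` which is the sum of a RATIONAL `q`-series on `ℍ` has rational Fourier coefficients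
  (`q`-expansions are unique, `ModularFormClass.qExpansion_coeff_unique`);
* `exists_rat_gamma1_presentation` — **`∃ k ≥ 1, F₁, G₁ ∈ S_k(Γ₁(N))` with RATIONAL Fourier coefficients, `G₁ ≠ 0`, `℘_{Λ_W}(ℰ_f)·G₁ = F₁` off the
  poles**: `G₁ = 12·G·Δ^a` for a RATIONAL `X₀`-presentation `(Fx, G)` of `℘_{φ(N)⁻¹Λ_W}(ℰ_f)` (`X1RatPres.exists_rat_isXPresentation`, Shimura 3.52),
  `F₁ = 12·℘_{Λ_W}(ℰ_f)·G·Δ^a` extended (p2's datum-free `CDivision.exists_cDivisionWitness_of_presentation`), a cusp form on `Γ₁(N)` by the growth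
  template `exists_exponent_isZeroAtImInfty`; its `q`-series near `i∞` is the Cauchy product of the RATIONAL cusp series of `12℘Δ^a`
  (`StevensCurve.ratCuspSeries`, no Honda) with that of `G`, extended to `ℍ` by the `q`-expansion extension principle
  (`QExpansionExtension.hasSum_of_hasSum_of_lt_im`).

HONEST FRAMING: analytic bookkeeping; no named fact used or introduced; nothing about C2/C3, T-es-75, Manin's conjecture or BSD is proved here.
[cite: ShimuraIATAF1971, Thm. 3.52 and Thm. 7.14] [cite: Stevens1989, §2] [cite: DiamondShurman2005, §1.1]
-/

set_option autoImplicit false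
-- lint-debt: the directory name repeats the summit name (sibling precedent `ManinLocalTwoThreeStevensCurvePresentation.lean`)
set_option linter.dupNamespace false

noncomputable section

open Complex Filter Topology Set Function PowerSeries
open UpperHalfPlane hiding I
open scoped Real Topology Manifold MatrixGroups PeriodPair ModularForm
open ModularForm CongruenceSubgroup
open Literature.NumberTheory.EllipticCurves Literature.NumberTheory.EllipticCurves.ModularForms
open Summit.BirchSwinnertonDyer.BirchSwinnertonDyer.Theorems.ManinLocalTwoThree.CDivCuspGerm

namespace Summit.BirchSwinnertonDyer.BirchSwinnertonDyer.Theorems.ManinLocalTwoThree.StevensCurve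

variable {N : ℕ} [NeZero N]

/-! ### `q`-series of cusp forms and rationality of Fourier coefficients -/

omit [NeZero N] in
/-- `Σ aₘ(G)·𝕢₁(τ)ᵐ = G(τ)` on `ℍ` for `G ∈ S_k(Γ₀(N))` (Mathlib `hasSum_qExpansion`, strict period `1`). [cite: DiamondShurman2005, §1.1] -/
theorem hasSum_qExpansion_coeff_gamma0 {k : ℤ} (G : CuspForm (Gamma0 N) k) (τ : ℍ) :
    HasSum (fun m : ℕ ↦ coeff m (qExpansion 1 ⇑G) * Function.Periodic.qParam 1 (τ : ℂ) ^ m) (G τ) := by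
  have hΓ := one_mem_strictPeriods_coe_gamma0 N
  haveI : Fact (IsCusp OnePoint.infty (Gamma0 N : Subgroup (GL (Fin 2) ℝ))) :=
    ⟨Subgroup.isCusp_of_mem_strictPeriods one_pos hΓ⟩
  have h := UpperHalfPlane.hasSum_qExpansion one_pos
    (SlashInvariantFormClass.periodic_comp_ofComplex G hΓ) (ModularFormClass.holo G)
    (ModularFormClass.bdd_at_infty G) τ
  refine h.congr_fun fun m ↦ ?_
  rw [smul_eq_mul]

omit [NeZero N] in
/-- **A cusp form on `Γ₁(N)` summed by a RATIONAL `q`-series on `ℍ` has rational Fourier coefficients** (uniqueness of `q`-expansions).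
[cite: DiamondShurman2005, §1.1] -/
theorem cuspCoeff_rat_of_hasSum {k : ℤ} (F : CuspForm (Gamma1 N) k) (P : ℚ⟦X⟧)
    (h : ∀ τ : ℍ, HasSum (fun m : ℕ ↦ coeff m (P.map (algebraMap ℚ ℂ)) * Function.Periodic.qParam 1 (τ : ℂ) ^ m) (F τ)) (n : ℕ) :
    ∃ q : ℚ, (q : ℂ) = cuspCoeff F n := by
  refine ⟨coeff n P, ?_⟩
  have h' : ∀ τ : ℍ, HasSum (fun m : ℕ ↦ coeff m (P.map (algebraMap ℚ ℂ)) • Function.Periodic.qParam 1 (τ : ℂ) ^ m) (F τ) := by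
    simpa only [smul_eq_mul] using h
  have hu := ModularFormClass.qExpansion_coeff_unique one_pos (HeckeTGamma1.one_mem_strictPeriods_Gamma1 N) (f := F) h' n
  rw [cuspCoeff, ← hu, coeff_map]
  simp

/-! ### The rational `Γ₁(N)`-presentation -/

/-- **A RATIONAL `Γ₁(N)`-presentation of `℘_{Λ_W}(ℰ_f)` under Stevens' inclusion.**  Let `W/ℚ` be elliptic with an `X₀(N)`-datum `D` and assume
`Λ₁(f) ⊆ Λ_W`.  Then there are `k ≥ 1` and `F₁, G₁ ∈ S_k(Γ₁(N))` with RATIONAL Fourier coefficients, `G₁ ≠ 0`, such that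
`℘_{Λ_W}(ℰ_f τ)·G₁(τ) = F₁(τ)` whenever `ℰ_f(τ) ∉ Λ_W`.  (`x(u_W(ℰ_f τ)) = ℘_{Λ_W}(ℰ_f τ) − b₂/12` is then presented by `(F₁ − (b₂/12)G₁, G₁)`.)
[cite: ShimuraIATAF1971, Thm. 3.52 and Thm. 7.14] [cite: Stevens1989, §2] -/
theorem exists_rat_gamma1_presentation {W : WeierstrassCurve ℚ} [W.IsElliptic] (D : ModularParametrizationData W N)
    (hSI : ∀ z ∈ periodLatticeGamma1 D.f, z ∈ D.L.lattice) :
    ∃ (k : ℤ) (F G : CuspForm (Gamma1 N) k), 1 ≤ k ∧ G ≠ 0 ∧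
      (∀ τ : ℍ, eichlerIntegral D.f τ ∉ D.L.lattice → ℘[D.L] (eichlerIntegral D.f τ) * G τ = F τ) ∧
      (∀ n, ∃ q : ℚ, (q : ℂ) = cuspCoeff F n) ∧ (∀ n, ∃ q : ℚ, (q : ℂ) = cuspCoeff G n) := by
  classical
  have hf : D.f ≠ 0 := D.isNewformOf.1.ne_zero
  have hrat : ∀ n, ∃ q : ℚ, (q : ℂ) = cuspCoeff D.f n := fun n ↦
    ⟨(W.LFunction n : ℚ), by rw [D.isNewformOf.2 n, Rat.cast_intCast]⟩
  -- `L' = φ(N)⁻¹·Λ_W ⊇ Λ₀(f)`, with rational invariants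
  have hn0 : ((Nat.totient N : ℕ) : ℂ) ≠ 0 := by exact_mod_cast (Nat.totient_pos.mpr (NeZero.pos N)).ne'
  set L' : PeriodPair := D.L.mulLeft (((Nat.totient N : ℕ) : ℂ)⁻¹) (inv_ne_zero hn0) with hL'
  have hLL' : ∀ z ∈ D.L.lattice, z ∈ L'.lattice := fun z hz ↦ by
    rw [hL', PeriodPair.mem_mulLeft_lattice, inv_inv]
    have h1 := nsmul_mem hz (Nat.totient N)
    rwa [nsmul_eq_mul] at h1
  have hΛ' : ∀ x ∈ periodLattice D.f, x ∈ L'.lattice := fun x hx ↦ by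
    rw [hL', PeriodPair.mem_mulLeft_lattice, inv_inv]
    exact hSI _ (totient_mul_mem_periodLatticeGamma1 D.f hx)
  have hg₂' : ∃ q : ℚ, (q : ℂ) = L'.g₂ := by
    refine ⟨((Nat.totient N : ℕ) : ℚ) ^ 4 * (W.c₄ / 12), ?_⟩
    rw [hL', PeriodPair.g₂_mulLeft, D.isNeronLattice.1, inv_pow, inv_inv]
    simp only [WeierstrassCurve.baseChange, WeierstrassCurve.map_c₄, eq_ratCast]
    push_cast
    ring
  have hg₃' : ∃ q : ℚ, (q : ℂ) = L'.g₃ := by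
    refine ⟨((Nat.totient N : ℕ) : ℚ) ^ 6 * (W.c₆ / 216), ?_⟩
    rw [hL', PeriodPair.g₃_mulLeft, D.isNeronLattice.2, inv_pow, inv_inv]
    simp only [WeierstrassCurve.baseChange, WeierstrassCurve.map_c₆, eq_ratCast]
    push_cast
    ring
  -- the rational `X₀`-presentation of `℘_{L'}(ℰ_f)` and the exponent
  obtain ⟨k, Fx, G, Dn, hk, hX, hDn, hGint⟩ :=
    DepletionAtTwo.X1RatPres.exists_rat_isXPresentation D.f hf hrat L' hΛ' hg₂' hg₃'
  have hk0 : 0 ≤ k := by omega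
  obtain ⟨a, ha2, hgrowth⟩ := exists_exponent_isZeroAtImInfty D.f hf D.L (Gamma1 N)
  obtain ⟨F, hFmd, hFeq, hiff⟩ := CDivision.exists_cDivisionWitness_of_presentation D.f hf hLL' hk0 hX a
  set K : ℕ := k.toNat + 12 * a with hKdef
  have hK : (K : ℤ) = k + 12 * a := by
    rw [hKdef]; push_cast; rw [Int.toNat_of_nonneg hk0]
  have hΓ₁ : ∀ γ : Gamma1 N, cuspSymbol D.f ⟨(γ : SL(2, ℤ)), Gamma1_in_Gamma0 N γ.2⟩ ∈ D.L.lattice := fun γ ↦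
    hSI _ (cuspSymbol_mem_periodLatticeGamma1 D.f γ)
  -- invariance of `F` under `Γ₁(N)` and vanishing at the cusps
  have hFslash : ∀ γ ∈ Gamma1 N, F ∣[(K : ℤ)] γ = F := fun γ hγ ↦ by
    rw [hK]
    exact (hiff ⟨γ, Gamma1_in_Gamma0 N hγ⟩).mp (hΓ₁ ⟨γ, hγ⟩)
  have hFzero : ∀ g : SL(2, ℤ), IsZeroAtImInfty (F ∣[(K : ℤ)] g) := by
    intro g
    rw [hK]
    refine hgrowth k G F (fun γ hγ ↦ ?_) (fun τ hτ ↦ ?_) g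
    · exact (hiff ⟨γ, Gamma1_in_Gamma0 N hγ⟩).mp (hΓ₁ ⟨γ, hγ⟩)
    · rw [← hFeq τ hτ]; ring
  -- the pole-killer `12·G·Δ^a`
  set Gt : ℍ → ℂ := fun τ ↦ 12 * G τ * ModularForm.discriminant τ ^ a with hGt
  have hGan : AnalyticOnNhd ℂ (Gt ∘ ofComplex) {z : ℂ | 0 < z.im} := CDivision.analyticOnNhd_twelve_mul_mul_discriminant_pow G a
  have hGtmd : MDifferentiable 𝓘(ℂ) 𝓘(ℂ) Gt := UpperHalfPlane.mdifferentiable_iff.mpr hGan.differentiableOn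
  have hGslash : ∀ γ ∈ Gamma1 N, Gt ∣[(K : ℤ)] γ = Gt := fun γ hγ ↦
    twelve_mul_mul_discriminant_pow_slash G a K hK γ (Gamma1_in_Gamma0 N hγ)
  have hGzero : ∀ g : SL(2, ℤ), IsZeroAtImInfty (Gt ∣[(K : ℤ)] g) := by
    intro g
    have h1 : IsZeroAtImInfty (⇑G ∣[k] g) := CuspFormClass.zero_at_infty_slash G g
    have hΔ : Tendsto (fun τ : ℍ ↦ ModularForm.discriminant τ ^ a) atImInfty (𝓝 0) := by
      have := (ModularForm.discriminant_isZeroAtImInfty : Tendsto _ _ _).pow a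
      rwa [zero_pow (by omega : a ≠ 0)] at this
    have h2 : Tendsto (fun τ : ℍ ↦ 12 * (⇑G ∣[k] g) τ * ModularForm.discriminant τ ^ a) atImInfty (𝓝 0) := by
      simpa using ((h1 : Tendsto _ _ _).const_mul (12 : ℂ)).mul hΔ
    refine (h2.congr' (Eventually.of_forall fun τ ↦ ?_) : Tendsto (Gt ∣[(K : ℤ)] g) atImInfty (𝓝 0))
    exact (twelve_mul_mul_discriminant_pow_slash_apply G a K hK g τ).symm
  -- packaging as cusp forms on `Γ₁(N)`
  let F₁ : CuspForm (Gamma1 N) (K : ℤ) :=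
    { toFun := F
      slash_action_eq' := fun A hA ↦ by
        obtain ⟨γ, hγ, rfl⟩ := hA
        exact hFslash γ hγ
      holo' := hFmd
      zero_at_cusps' := fun {c} hc ↦ by
        rw [Subgroup.IsArithmetic.isCusp_iff_isCusp_SL2Z] at hc
        rw [OnePoint.isZeroAt_iff_forall_SL2Z hc]
        intro g _
        exact hFzero g }
  let G₁ : CuspForm (Gamma1 N) (K : ℤ) :=
    { toFun := Gt
      slash_action_eq' := fun A hA ↦ by
        obtain ⟨γ, hγ, rfl⟩ := hA
        exact hGslash γ hγ
      holo' := hGtmd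
      zero_at_cusps' := fun {c} hc ↦ by
        rw [Subgroup.IsArithmetic.isCusp_iff_isCusp_SL2Z] at hc
        rw [OnePoint.isZeroAt_iff_forall_SL2Z hc]
        intro g _
        exact hGzero g }
  have hK1 : (1 : ℤ) ≤ K := by omega
  -- the rational `q`-series of `G`, `Δ^a`, `G₁ = 12·G·Δ^a`
  have hDnC : (Dn : ℂ) ≠ 0 := by exact_mod_cast hDn.ne'
  choose z hz using hGint
  set Gq : ℚ⟦X⟧ := PowerSeries.mk fun m ↦ (z m : ℚ) / Dn with hGq
  have hGqexp : qExpansion 1 ⇑G = Gq.map (algebraMap ℚ ℂ) := by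
    ext m
    rw [coeff_map, hGq, coeff_mk]
    have h1 : coeff m (qExpansion 1 ⇑G) = cuspCoeff G m := rfl
    have h2 : cuspCoeff G m = (z m : ℂ) / (Dn : ℂ) := by
      rw [eq_div_iff hDnC, mul_comm]
      exact hz m
    rw [h1, h2]
    simp
  set R : ℤ⟦X⟧ := (X * formalDeltaUnit) ^ a with hR
  set G₁q : ℚ⟦X⟧ := C (12 : ℚ) * Gq * R.map (Int.castRingHom ℚ) with hG₁q
  have hG₁sum : ∀ τ : ℍ, HasSum (fun m : ℕ ↦ coeff m (G₁q.map (algebraMap ℚ ℂ)) * Function.Periodic.qParam 1 (τ : ℂ) ^ m) (G₁ τ) := by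
    intro τ
    set q := Function.Periodic.qParam 1 (τ : ℂ) with hq
    have hGs : HasSum (fun m : ℕ ↦ coeff m ((C (12 : ℚ) * Gq).map (algebraMap ℚ ℂ)) * q ^ m) (12 * G τ) := by
      have h := (hasSum_qExpansion_coeff_gamma0 G τ).mul_left (12 : ℂ)
      have hfun : (fun m : ℕ ↦ coeff m ((C (12 : ℚ) * Gq).map (algebraMap ℚ ℂ)) * q ^ m) =
          fun m : ℕ ↦ 12 * (coeff m (qExpansion 1 ⇑G) * Function.Periodic.qParam 1 (τ : ℂ) ^ m) := by
        funext m
        rw [hGqexp, map_mul, map_C, coeff_C_mul, hq]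
        simp [mul_assoc]
      rw [hfun]
      exact h
    have hΔa : HasSum (fun m : ℕ ↦ coeff m ((R.map (Int.castRingHom ℚ)).map (algebraMap ℚ ℂ)) * q ^ m) (ModularForm.discriminant τ ^ a) := by
      have h := hasSum_intCoeff_pow (Literature.NumberTheory.EllipticCurves.hasSum_X_mul_formalDeltaUnit τ) a
      convert h using 2 with m
      rw [coeff_map, coeff_map, hR, hq]
      simp
    have hprod := KummerCubeSigmaLeaves.hasSum_coeff_mul_pow_mul hGs hΔa
    rw [← map_mul] at hprod
    convert hprod using 1
    show Gt τ = 12 * G τ * ModularForm.discriminant τ ^ a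
    rfl
  -- the rational `q`-series of `F₁` near `i∞`, extended to `ℍ`
  obtain ⟨g, B, hg⟩ := ratCuspSeries W D a ha2
  obtain ⟨T, hT⟩ := exists_forall_eichlerIntegral_smul_notMem D.f hf D.L 1
  have hF₁near : ∀ τ : ℍ, max B T < τ.im →
      HasSum (fun m : ℕ ↦ coeff m ((g * Gq).map (algebraMap ℚ ℂ)) * Function.Periodic.qParam 1 (τ : ℂ) ^ m) (F τ) := by
    intro τ hτ
    set q := Function.Periodic.qParam 1 (τ : ℂ) with hq
    have hB : B < τ.im := lt_of_le_of_lt (le_max_left _ _) hτ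
    have hTτ : T ≤ τ.im := (le_max_right _ _).trans hτ.le
    have hnot : eichlerIntegral D.f τ ∉ D.L.lattice := by simpa using hT τ hTτ
    have hΦ : HasSum (fun m : ℕ ↦ coeff m (g.map (algebraMap ℚ ℂ)) * q ^ m)
        ((12 : ℂ) * ℘[D.L] (eichlerIntegral D.f τ) * ModularForm.discriminant τ ^ a) := by
      convert hg τ hB using 2 with m
      rw [coeff_map, hq]
      simp
    have hGs : HasSum (fun m : ℕ ↦ coeff m (Gq.map (algebraMap ℚ ℂ)) * q ^ m) (G τ) := by
      have h := hasSum_qExpansion_coeff_gamma0 G τ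
      rwa [hGqexp] at h
    have hprod := KummerCubeSigmaLeaves.hasSum_coeff_mul_pow_mul hΦ hGs
    rw [← map_mul] at hprod
    convert hprod using 1
    rw [← hFeq τ hnot]
    ring
  have hF₁sum : ∀ τ : ℍ, HasSum (fun m : ℕ ↦ coeff m ((g * Gq).map (algebraMap ℚ ℂ)) * Function.Periodic.qParam 1 (τ : ℂ) ^ m) (F₁ τ) :=
    fun τ ↦ QExpansionExtension.hasSum_of_hasSum_of_lt_im hFmd hF₁near τ
  refine ⟨(K : ℤ), F₁, G₁, hK1, ?_, fun τ hτ ↦ ?_, cuspCoeff_rat_of_hasSum F₁ (g * Gq) hF₁sum, cuspCoeff_rat_of_hasSum G₁ G₁q hG₁sum⟩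
  · -- `G₁ ≠ 0`: `G ≠ 0` and `Δ` has no zeros
    obtain ⟨τ₁, hτ₁⟩ := DFunLike.ne_iff.mp hX.1
    have hG1 : G τ₁ ≠ 0 := by simpa using hτ₁
    have hGt1 : Gt τ₁ ≠ 0 :=
      mul_ne_zero (mul_ne_zero (by norm_num) hG1) (pow_ne_zero _ (ModularForm.discriminant_ne_zero τ₁))
    intro h0
    apply hGt1
    have h1 := DFunLike.congr_fun h0 τ₁
    exact h1
  · show ℘[D.L] (eichlerIntegral D.f τ) * Gt τ = F τ
    rw [← hFeq τ hτ, hGt]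
    ring

end Summit.BirchSwinnertonDyer.BirchSwinnertonDyer.Theorems.ManinLocalTwoThree.StevensCurve

end
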